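import Summits.NavierStokesRegularity.NavierStokesRegularity.Theorems.PerpetualPumpEulerTypeIGlueFourierL2
import Summits.NavierStokesRegularity.NavierStokesRegularity.Theorems.PerpetualPumpEulerTypeIGlueHeatPairing
import Literature.Analysis.FluidPDE.TaoCascadeProjection
import Literature.Analysis.FluidPDE.TaoAveragedEulerLerayL2

/-!
# Route PerpetualPump · `EulerTypeIGlue` — density of divergence-free test fields in the real
# divergence-free part of `L²(ℝ³; ℂ³)`

Support file for the support item `EulerTypeIGlue` (stmt-NavierStokesRegularity-1838) of route
PerpetualPump.  Tao's mild solutions (2016, (1.15)) are tested against all `w ∈ H¹⁰_df(ℝ³)`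
(`MemH10df`: `H¹⁰`, real, `ξ·ŵ(ξ) = 0` a.e.), the tree's physical-space mild solutions against
`φ ∈ C_{c,σ}^∞` (`divFreeTest`).  To pass from the latter to the former one needs that every real,
Fourier-divergence-free `w ∈ L²(ℝ³; ℂ³)` is an `L²` limit of complexified divergence-free test
fields (`exists_divFreeTest_tendsto`).  Proof: the real part `Re w ∈ L²(ℝ³; ℝ³)` is weakly
divergence free (`∫ ⟪Re w, ∇θ⟫ = ⟨w, [∇θ^ℂ]⟩ = ∫ ŵ(ξ)·𝓕[∇θ^ℂ](-ξ) dξ = 0`, as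
`𝓕[∇θ](η) = 2πi θ̂(η) η` and `ξ·ŵ(ξ) = 0`), hence lies in `L²_σ = closure 𝒱` by the tree's
Helmholtz characterisation `mem_solenoidalL2_iff_holds` (Temam 1977, Ch. I, Thm. 1.4/1.6), and
complexification is isometric.

## References

* R. Temam, *Navier–Stokes Equations* (North-Holland 1977), Ch. I, Thm. 1.4, Rem. 1.6, Thm. 1.6.
* T. Tao, J. Amer. Math. Soc. 29 (2016), arXiv:1402.0290v3, §1.1 (1.15). [Tao2016AveragedNS]
-/

noncomputable section

open MeasureTheory Set Filter Topology FourierTransform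
open scoped ENNReal NNReal FourierTransform RealInnerProductSpace ComplexConjugate

set_option linter.dupNamespace false

namespace Summit.NavierStokesRegularity.NavierStokesRegularity.Theorems.PerpetualPumpEulerTypeIGlue

open Literature.Analysis.FluidPDE Literature.Analysis.FluidPDE.Tao2016
open Literature.Analysis.FunctionSpaces.EuclideanSpace (complexify complexify_apply norm_complexify
  continuous_complexify)

/-- Local notation for physical / frequency space `ℝ³`. -/
local notation "ℝ³" => EuclideanSpace ℝ (Fin 3)
/-- Local notation for the complexified range `ℂ³`. -/
local notation "ℂ³" => EuclideanSpace ℂ (Fin 3)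

section Density

/-! ### Real parts of real `L²` classes -/

/-- A vector with real coordinates is the complexification of its real part. [folklore] -/
theorem complexify_realPart_of_im_eq_zero {z : ℂ³} (hz : ∀ i, (z i).im = 0) :
    complexify (realPart z) = z := by
  ext i
  rw [complexify_apply, realPart_apply]
  apply Complex.ext
  · simp
  · simp [hz i]

/-- `‖Re z‖ ≤ ‖z‖`. [folklore] -/
theorem norm_realPart_le (z : ℂ³) : ‖realPart z‖ ≤ ‖z‖ := by
  have h := lipschitzWith_one_realPart.norm_sub_le z 0
  have h0 : realPart (0 : ℂ³) = 0 := by ext i; simp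
  simpa [h0] using h

/-- A real `L²(ℝ³; ℂ³)` class is represented by the complexification of its real part. [folklore] -/
theorem IsReal.ae_eq_complexify_realPart {w : L2C} (hw : IsReal w) :
    (w : ℝ³ → ℂ³) =ᵐ[volume] complexify ∘ (realPart ∘ (w : ℝ³ → ℂ³)) := by
  filter_upwards [hw] with x hx
  rw [Function.comp_apply, Function.comp_apply, complexify_realPart_of_im_eq_zero hx]

/-- The real part of an `L²(ℝ³; ℂ³)` class is in `L²(ℝ³; ℝ³)`. [folklore] -/
theorem memLp_realPart (w : L2C) : MemLp (realPart ∘ (w : ℝ³ → ℂ³)) 2 (volume : Measure ℝ³) :=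
  MemLp.of_le (Lp.memLp w) (continuous_realPart.comp_aestronglyMeasurable (Lp.aestronglyMeasurable w))
    (Eventually.of_forall fun _ => norm_realPart_le _)

/-- Complexification preserves `L²`. [folklore] -/
theorem memLp_complexify_of_memLp {g : ℝ³ → ℝ³} (hg : MemLp g 2 (volume : Measure ℝ³)) :
    MemLp (complexify ∘ g) 2 (volume : Measure ℝ³) :=
  ContinuousLinearMap.comp_memLp' complexify.toContinuousLinearMap hg

/-! ### Fourier-divergence-free ⇒ weakly divergence free -/

/-- **The Fourier transform of a complexified gradient**: `𝓕[(∇θ)^ℂ](η) = (2πi θ̂(η)) η^ℂ` for a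
`C¹` compactly supported real `θ` (Stein–Weiss 1971, Ch. I, Thm. 1.8). [folklore] -/
theorem fourier_complexify_gradient {θ : ℝ³ → ℝ} (hθ : ContDiff ℝ 1 θ) (hθc : HasCompactSupport θ)
    (hΘi : Integrable (complexify ∘ gradient θ)) (η : ℝ³) :
    𝓕 (complexify ∘ gradient θ) η =
      (2 * Real.pi * Complex.I * 𝓕 (fun x => (θ x : ℂ)) η) • complexify η := by
  classical
  ext j
  rw [LerayDivFree.fourier_apply_coord hΘi, PiLp.smul_apply, complexify_apply, smul_eq_mul]
  have hgrad : (fun x => (complexify ∘ gradient θ) x j) =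
      fun x => ((fderiv ℝ θ x (EuclideanSpace.single j 1) : ℝ) : ℂ) := by
    funext x
    simp only [Function.comp_apply, complexify_apply, gradient_apply_eq_fderiv]
  rw [hgrad, fourier_fderiv_apply_ofReal hθ hθc, EuclideanSpace.inner_single_right]
  simp only [conj_trivial, one_mul]
  ring

/-- **A real, Fourier-divergence-free `L²` class has a weakly divergence-free real part**:
`ξ · ŵ(ξ) = 0` a.e. implies `∫ ⟪Re w, ∇θ⟫ = 0` for every test function `θ`
(Parseval `⟨w, z⟩ = ∫ ŵ(ξ)·ẑ(-ξ)` and `𝓕[∇θ^ℂ](η) = 2πi θ̂(η) η`). [folklore] -/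
theorem isWeaklyDivFree_realPart {w : L2C} (hre : IsReal w) (hdf : IsFourierDivFree w) :
    IsWeaklyDivFree (realPart ∘ (w : ℝ³ → ℂ³)) := by
  intro θ hθ
  have hθ1 : ContDiff ℝ 1 θ := hθ.contDiff.of_le (by exact_mod_cast le_top)
  have hgc : Continuous (gradient θ) :=
    (InnerProductSpace.toDual ℝ ℝ³).symm.continuous.comp (hθ.contDiff.continuous_fderiv (by simp))
  have hgs : HasCompactSupport (gradient θ) :=
    (hθ.hasCompactSupport.fderiv (𝕜 := ℝ)).comp_left
      (g := (InnerProductSpace.toDual ℝ ℝ³).symm) (map_zero _)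
  have hΘc : Continuous (complexify ∘ gradient θ) := continuous_complexify.comp hgc
  have hΘs : HasCompactSupport (complexify ∘ gradient θ) := hgs.comp_left (map_zero _)
  have hΘi : Integrable (complexify ∘ gradient θ) := hΘc.integrable_of_hasCompactSupport hΘs
  have hΘ2 : MemLp (complexify ∘ gradient θ) 2 (volume : Measure ℝ³) :=
    hΘc.memLp_of_hasCompactSupport hΘs
  -- physical side
  have hx := pairing_eq_integral_inner_of_ae_eq (IsReal.ae_eq_complexify_realPart hre) hΘ2
  -- Fourier side
  have hF : pairing w (hΘ2.toLp _) = 0 := by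
    rw [pairing_eq_integral_cdot_fourierFn]
    have h1 : fourierFn (hΘ2.toLp _) =ᵐ[volume] 𝓕 (complexify ∘ gradient θ) :=
      Literature.Analysis.FunctionSpaces.fourier_toLp_ae_eq_fourierIntegral hΘi hΘ2
    have h2 : ∀ᵐ ξ : ℝ³ ∂volume, fourierFn (hΘ2.toLp _) (-ξ) = 𝓕 (complexify ∘ gradient θ) (-ξ) :=
      (Measure.measurePreserving_neg (volume : Measure ℝ³)).quasiMeasurePreserving.ae_eq h1
    refine (integral_congr_ae ?_).trans (integral_zero _ _)
    filter_upwards [h2, hdf] with ξ hξ hdiv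
    have hneg : cdot (fourierFn w ξ) (complexify (-ξ)) = -cdot (complexify ξ) (fourierFn w ξ) := by
      unfold cdot
      rw [← Finset.sum_neg_distrib]
      refine Finset.sum_congr rfl fun i _ => ?_
      rw [map_neg, PiLp.neg_apply]
      ring
    rw [hξ, fourier_complexify_gradient hθ1 hθ.hasCompactSupport hΘi, cdot_smul_right, hneg, hdiv,
      neg_zero, mul_zero]
  rw [hF] at hx
  exact_mod_cast hx.symm

/-! ### The density statement -/

/-- **`C_{c,σ}^∞` is dense in the real divergence-free part of `L²(ℝ³; ℂ³)`**: a real,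
Fourier-divergence-free `w ∈ L²(ℝ³; ℂ³)` is the `L²` limit of complexified smooth compactly
supported divergence-free fields (Temam 1977, Ch. I, Thm. 1.4/1.6, `L²_σ = closure 𝒱`, through the
tree's `mem_solenoidalL2_iff_holds` and `denseRange_divFreeTestToSolenoidalL2`). [cite: Temam1977, Ch. I Thm. 1.4 with Rem. 1.6 / Thm. 1.6] -/
theorem exists_divFreeTest_tendsto {w : L2C} (hre : IsReal w) (hdf : IsFourierDivFree w) :
    ∃ (φ : ℕ → (ℝ³ → ℝ³)) (_ : ∀ n, φ n ∈ divFreeTest ℝ³)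
      (h2 : ∀ n, MemLp (complexify ∘ φ n) 2 (volume : Measure ℝ³)),
      Tendsto (fun n => ((h2 n).toLp (complexify ∘ φ n) : L2C)) atTop (𝓝 w) := by
  set f : ℝ³ → ℝ³ := realPart ∘ (w : ℝ³ → ℂ³) with hf
  have hf2 : MemLp f 2 (volume : Measure ℝ³) := memLp_realPart w
  have hwf : (w : ℝ³ → ℂ³) =ᵐ[volume] complexify ∘ f := IsReal.ae_eq_complexify_realPart hre
  set F : Lp ℝ³ 2 (volume : Measure ℝ³) := hf2.toLp f with hF
  have hFdiv : IsWeaklyDivFree (F : ℝ³ → ℝ³) :=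
    (isWeaklyDivFree_realPart hre hdf).congr_ae hf2.coeFn_toLp.symm
  have hFmem : F ∈ solenoidalL2 ℝ³ := (mem_solenoidalL2_iff_holds F).2 hFdiv
  -- a sequence of divergence-free test fields converging to `F` in `L²(ℝ³; ℝ³)`
  have hcl : (⟨F, hFmem⟩ : solenoidalL2 ℝ³) ∈ closure (range (divFreeTestToSolenoidalL2 ℝ³)) := by
    rw [denseRange_divFreeTestToSolenoidalL2.closure_range]
    exact mem_univ _
  obtain ⟨x, hx, hxt⟩ := mem_closure_iff_seq_limit.1 hcl
  choose ψ hψ using hx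
  have h2c : ∀ n, MemLp (complexify ∘ (ψ n : ℝ³ → ℝ³)) 2 (volume : Measure ℝ³) := fun n =>
    memLp_complexify_of_memLp (memLp_of_mem_divFreeTest (ψ n).2 2)
  refine ⟨fun n => (ψ n : ℝ³ → ℝ³), fun n => (ψ n).2, h2c, ?_⟩
  have hT : Tendsto (fun n => (divFreeTestToL2 ℝ³ (ψ n) : Lp ℝ³ 2 (volume : Measure ℝ³))) atTop (𝓝 F) := by
    have h := (continuous_subtype_val.tendsto _).comp hxt
    refine h.congr fun n => ?_
    rw [Function.comp_apply, ← hψ n, coe_divFreeTestToSolenoidalL2]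
  rw [tendsto_iff_norm_sub_tendsto_zero] at hT ⊢
  refine hT.congr fun n => ?_
  rw [Lp.norm_def, Lp.norm_def]
  congr 1
  refine eLpNorm_congr_norm_ae ?_
  filter_upwards [Lp.coeFn_sub (divFreeTestToL2 ℝ³ (ψ n)) F, coeFn_divFreeTestToL2 (ψ n),
    hf2.coeFn_toLp, Lp.coeFn_sub ((h2c n).toLp _) w, (h2c n).coeFn_toLp, hwf]
    with y h1 h2 h3 h4 h5 h6
  rw [h1, Pi.sub_apply, h2, h3, h4, Pi.sub_apply, h5, h6, Function.comp_apply,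
    Function.comp_apply, ← map_sub, norm_complexify]

end Density

end Summit.NavierStokesRegularity.NavierStokesRegularity.Theorems.PerpetualPumpEulerTypeIGlue

end
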